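import Mathlib
import Literature.Computability.AlgebraicComplexity.FS12RankCondenser
import HarnessLib

/-!
# Forbes–Shpilka 2013, §3.1 "Derandomized Kronecker product for the span of an ABP":
# Lemmas 3.2, 3.3, 3.5, 3.6 (arXiv: Lemmas 7, 8, 10, 12) — proofs, no named facts

M. A. Forbes, A. Shpilka, *Quasipolynomial-time identity testing of non-commutative and read-once
oblivious algebraic branching programs*, FOCS 2013 = arXiv:1209.2408 [ForbesShpilka2013], §3.1
(paper:arxiv-1209.2408 p0013–p0014). These are the span lemmas behind the Forbes–Shpilka
generator for read-once oblivious ABPs, i.e. behind the N1-residual named fact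
`ForbesShpilkaVolk2018_lemma55` (`FSV2018ROABP.lean`; FSV 2018 Lemma 55 = [FS13, Construction
3.13 / Thm. 3.21]); Lemma 3.4 (= [ForbesShpilka2012, Cor. 4.3], the `(g^i α)^j` rank condenser)
is `FS12RankCondenser.lean`. This file is a step towards that fact and discharges nothing by
itself; nothing here bears on `VP ≠ VNP`.

* `span_mul_eq_span_span_mul_span`, `span_mul_eq_of_span_eq` — **Lemma 3.2** (arXiv Lemma 7):
  `span(𝒜·ℬ) = span(span 𝒜 · span ℬ)`, hence spans of products only depend on the spans
  (Mathlib's `Submodule.span_mul_span`).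
* `span_eval_eq_span_coeff` — **Lemma 3.3** (arXiv Lemma 8): for a matrix `M` of univariate
  polynomials of degree `< d` and `|S| ≥ d`, `span{M(β)}_{β∈S} = span{coef_i(M)}_{i<d}`
  (`⊆` for every `β`: `map_eval_mem_span_coeff`; `⊇` by Lagrange interpolation:
  `map_coeff_mem_span_eval`).
* `span_evalProducts_le`, `card_lt_of_span_evalProducts_ne` — **Lemma 3.5** (arXiv Lemma 10):
  for `M ∈ K[x]^{r×r}`, `N ∈ K[y]^{r×r}` of degree `< n` and `1, ω, …, ω^{n²-1}` distinct,
  `span{M(ω^ℓα) N((ω^ℓα)^n)}_{ℓ<r²} ⊆ span{coef_i(M) coef_j(N)}_{i,j<n}` for every `α`, with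
  equality except for `< n²r²` values of `α` (every finite set of exceptional `α` has `< n²r²`
  elements). The coefficient `coef_{x^iy^j}(M(x)N(y))` of the printed statement is written directly
  as `coef_i(M) · coef_j(N)` (the product is variable-disjoint), so no bivariate polynomial ring is
  needed. Proof as printed: flatten to the `n² × r²` coefficient matrix `C` and apply Lemma 3.4
  (`FS2012.card_lt_of_rank_lt`) — the rows of `A_α C` are the flattened `M(ω^ℓα) N((ω^ℓα)^n)`.
* `span_evalProd_le_span_of_nodes`, `card_lt_of_not_span_evalProd_le` — **Lemma 3.6** (arXiv
  Lemma 12), the merging step, with ABSTRACT nodes and curves: for layers `R(x)`, `T(y)` of degree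
  `< d` (print: `R = ∏_i M_i(f_i(x))`, `T = ∏_i N_i(g_i(y))`, `d = Dnm`) and any matrix-valued
  curves `U_α, V_α` with `U_α(β_ℓ) = R(ω^ℓα)`, `V_α(β_ℓ) = T((ω^ℓα)^d)` (print: the Lagrange
  interpolants through the evaluation points), `span{R(x)T(y)}_{x,y∈K} ⊆ span{U_α(z)V_α(z)}_{z∈K}`
  for all but `< d²r²` values of `α` (`span_eval_univ_eq_span_coeff`,
  `span_evalProd_univ_eq_span_coeff` = eq. (2) of the printed proof). The printed instance —
  `D`-fold layer products composed with curves, Lagrange polynomials `p_ℓ` (Def. 3.? / arXiv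
  Def. 11), Construction 3.13 — is NOT yet typed here (successor step).

Typed over one field `K` (the printed `𝔽 ⊆ 𝕂` distinction only matters for where `α, ω` live; a
matrix over a subfield is a matrix over `K` of the same span dimension). No definitions, no named
facts.

## References
* [ForbesShpilka2013] arXiv:1209.2408 §3.1, Lemmas 3.2, 3.3, 3.5, 3.6 (arXiv numbering 7, 8,
  10, 12) (locator: paper:arxiv-1209.2408 p0013.txt:L22 – p0014.txt:L43).
* [ForbesShpilka2012] arXiv:1111.0663 Thm. 4.1 / Cor. 4.3 (= FS13 Lemma 3.4; `FS12RankCondenser`).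
* [ForbesShpilkaVolk2018] Lemma 55 (seq.; = ToC Lemma 7.1) — the consumer.
-/

noncomputable section

namespace Literature.Computability.AlgebraicComplexity

namespace FS2013

open Polynomial Matrix Finset

open scoped BigOperators Pointwise

variable {K : Type*} [Field K]

/-! ### Lemma 3.2 (arXiv Lemma 7): spans of products of families of matrices -/

/-- **[ForbesShpilka2013, Lemma 3.2 (arXiv Lemma 7)], first claim:** `span(𝒜 · ℬ) =
span(span(𝒜) · span(ℬ))` for sets `𝒜, ℬ` of (linear transformations =) elements of a `K`-algebra
("by bilinearity of the matrix product"). In Mathlib: `Submodule.span_mul_span`.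
[cite: ForbesShpilka2013, Lemma 3.2 (arXiv: Lemma 7)] locator: paper:arxiv-1209.2408 p0013.txt:L24–L31 -/
theorem span_mul_eq_span_span_mul_span {A : Type*} [Semiring A] [Algebra K A] (𝒜 ℬ : Set A) :
    Submodule.span K (𝒜 * ℬ) =
      Submodule.span K ((Submodule.span K 𝒜 : Set A) * (Submodule.span K ℬ : Set A)) := by
  rw [← Submodule.span_mul_span, ← Submodule.span_mul_span, Submodule.span_eq, Submodule.span_eq]

/-- **[ForbesShpilka2013, Lemma 3.2 (arXiv Lemma 7)], second claim:** if `span 𝒜 = span 𝒜'` and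
`span ℬ = span ℬ'` then `span(𝒜 · ℬ) = span(𝒜' · ℬ')`.
[cite: ForbesShpilka2013, Lemma 3.2 (arXiv: Lemma 7)] locator: paper:arxiv-1209.2408 p0013.txt:L24–L33 -/
theorem span_mul_eq_of_span_eq {A : Type*} [Semiring A] [Algebra K A] {𝒜 𝒜' ℬ ℬ' : Set A}
    (hA : Submodule.span K 𝒜 = Submodule.span K 𝒜')
    (hB : Submodule.span K ℬ = Submodule.span K ℬ') :
    Submodule.span K (𝒜 * ℬ) = Submodule.span K (𝒜' * ℬ') := by
  rw [← Submodule.span_mul_span, ← Submodule.span_mul_span, hA, hB]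

/-! ### Lemma 3.3 (arXiv Lemma 8): the span of a layer equals the span of its coefficients -/

section Layer

variable {m m' : Type*}

/-- `M(β) = Σ_{i<d} β^i · coef_i(M)` for a matrix of univariate polynomials of degree `< d`
("`M(α) = Σ_{i=0}^{deg M} coef_i(M) α^i`").
[cite: ForbesShpilka2013, Lemma 3.3 (arXiv: Lemma 8), proof (⊆)] locator: paper:arxiv-1209.2408 p0013.txt:L43–L44 -/
theorem map_eval_eq_sum_smul_coeff (M : Matrix m m' K[X]) {d : ℕ}
    (hM : ∀ a b, (M a b).natDegree < d) (β : K) :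
    M.map (Polynomial.eval β) = ∑ i ∈ Finset.range d, β ^ i • M.map fun f => f.coeff i := by
  ext a b
  simp only [Matrix.map_apply, Matrix.sum_apply, Matrix.smul_apply, smul_eq_mul]
  rw [Polynomial.eval_eq_sum_range' (hM a b)]
  exact Finset.sum_congr rfl fun i _ => mul_comm _ _

/-- `M(β) ∈ span{coef_i(M)}_{i<d}` for EVERY `β`.
[cite: ForbesShpilka2013, Lemma 3.3 (arXiv: Lemma 8), "⊆"] locator: paper:arxiv-1209.2408 p0013.txt:L43–L44 -/
theorem map_eval_mem_span_coeff (M : Matrix m m' K[X]) {d : ℕ}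
    (hM : ∀ a b, (M a b).natDegree < d) (β : K) :
    M.map (Polynomial.eval β) ∈
      Submodule.span K (Set.range fun i : Fin d => M.map fun f => f.coeff (i : ℕ)) := by
  rw [map_eval_eq_sum_smul_coeff M hM β]
  refine Submodule.sum_mem _ fun i hi => Submodule.smul_mem _ _ (Submodule.subset_span ?_)
  exact ⟨⟨i, Finset.mem_range.mp hi⟩, rfl⟩

/-- `coef_k(M) ∈ span{M(β)}_{β∈S}` as soon as `|S| ≥ d > deg M`: Lagrange interpolation on `d`
nodes of `S` expresses each coefficient functional as a fixed combination of evaluations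
("there is a set of constants `{a_{i,α}}_{α∈S}` such that … `coef_i(f) = Σ_{α∈S} a_{i,α} f(α)`.
Applying this relation entry-wise we obtain `coef_i(M) = Σ_{α∈S} a_{i,α} M(α)`").
[cite: ForbesShpilka2013, Lemma 3.3 (arXiv: Lemma 8), "⊇"] locator: paper:arxiv-1209.2408 p0013.txt:L46–L49 -/
theorem map_coeff_mem_span_eval (M : Matrix m m' K[X]) {d : ℕ}
    (hM : ∀ a b, (M a b).natDegree < d) (S : Finset K) (hS : d ≤ S.card) (k : ℕ) :
    (M.map fun f => f.coeff k) ∈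
      Submodule.span K (Set.range fun β : S => M.map (Polynomial.eval (β : K))) := by
  classical
  obtain ⟨T, hTS, hTcard⟩ := Finset.exists_subset_card_eq hS
  have hinj : Set.InjOn (id : K → K) (T : Set K) := Set.injOn_id _
  have key : (M.map fun f => f.coeff k) =
      ∑ β ∈ T, (Lagrange.basis T id β).coeff k • M.map (Polynomial.eval β) := by
    ext a b
    simp only [Matrix.map_apply, Matrix.sum_apply, Matrix.smul_apply, smul_eq_mul]
    have hdeg : (M a b).degree < (T.card : WithBot ℕ) := by
      rw [hTcard]
      exact lt_of_le_of_lt Polynomial.degree_le_natDegree (WithBot.coe_lt_coe.mpr (hM a b))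
    conv_lhs => rw [Lagrange.eq_interpolate hinj hdeg]
    rw [Lagrange.interpolate_apply, Polynomial.finsetSum_coeff]
    refine Finset.sum_congr rfl fun β _ => ?_
    rw [Polynomial.coeff_C_mul, mul_comm]
    rfl
  rw [key]
  refine Submodule.sum_mem _ fun β hβ => Submodule.smul_mem _ _ (Submodule.subset_span ?_)
  exact ⟨⟨β, hTS hβ⟩, rfl⟩

/-- **[ForbesShpilka2013, Lemma 3.3 (arXiv Lemma 8)]:** "Let `M ∈ 𝔽[x]^{r×r}`. Then for any set
`S ⊆ 𝔽` with `|S| > deg(M)`, `span{M(α)}_{α∈S} = span{coef^i(M)}_{i=0}^{deg(M)}`." Typed for a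
matrix of univariate polynomials of (entrywise) degree `< d` and any `S` with `|S| ≥ d` (shape of
`M` arbitrary). [cite: ForbesShpilka2013, Lemma 3.3 (arXiv: Lemma 8)]
locator: paper:arxiv-1209.2408 p0013.txt:L39–L49 -/
theorem span_eval_eq_span_coeff (M : Matrix m m' K[X]) {d : ℕ}
    (hM : ∀ a b, (M a b).natDegree < d) (S : Finset K) (hS : d ≤ S.card) :
    Submodule.span K (Set.range fun β : S => M.map (Polynomial.eval (β : K))) =
      Submodule.span K (Set.range fun i : Fin d => M.map fun f => f.coeff (i : ℕ)) := by
  apply le_antisymm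
  · rw [Submodule.span_le]
    rintro _ ⟨β, rfl⟩
    exact map_eval_mem_span_coeff M hM β
  · rw [Submodule.span_le]
    rintro _ ⟨i, rfl⟩
    exact map_coeff_mem_span_eval M hM S hS i

end Layer

/-! ### Lemma 3.5 (arXiv Lemma 10): dimension reduction for a two-layer product `M(x) N(y)` -/

section DimensionReduction

variable {r n : ℕ}

/-- `M(β) N(γ) = Σ_{i,j<n} β^i γ^j · coef_i(M) coef_j(N)` ("`M(ω^ℓα) N((ω^ℓα)^n) =
Σ_{i,j} coef_{x^iy^j}(M(x)N(y)) · (ω^ℓα)^{i+nj}`"; `coef_{x^iy^j}(M(x)N(y)) = coef_i(M) coef_j(N)`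
for the variable-disjoint product).
[cite: ForbesShpilka2013, Lemma 3.5 (arXiv: Lemma 10), proof (⊇)] locator: paper:arxiv-1209.2408 p0014.txt:L10 -/
theorem eval_mul_eval_eq_sum (M N : Matrix (Fin r) (Fin r) K[X])
    (hM : ∀ a b, (M a b).natDegree < n) (hN : ∀ a b, (N a b).natDegree < n) (β γ : K) :
    M.map (Polynomial.eval β) * N.map (Polynomial.eval γ) =
      ∑ ij : Fin n × Fin n, (β ^ (ij.1 : ℕ) * γ ^ (ij.2 : ℕ)) •
        ((M.map fun f => f.coeff (ij.1 : ℕ)) * N.map fun f => f.coeff (ij.2 : ℕ)) := by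
  rw [map_eval_eq_sum_smul_coeff M hM, map_eval_eq_sum_smul_coeff N hN, Finset.sum_mul_sum,
    Fintype.sum_prod_type, Finset.sum_range (fun i => ∑ j ∈ Finset.range n,
      (β ^ i • M.map fun f => f.coeff i) * (γ ^ j • N.map fun f => f.coeff j))]
  refine Finset.sum_congr rfl fun i _ => ?_
  rw [Finset.sum_range (fun j => (β ^ (i : ℕ) • M.map fun f => f.coeff (i : ℕ)) *
    (γ ^ j • N.map fun f => f.coeff j))]
  refine Finset.sum_congr rfl fun j _ => ?_
  rw [smul_mul_assoc, mul_smul_comm, smul_smul]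

/-- **[ForbesShpilka2013, Lemma 3.5 (arXiv Lemma 10)], first claim (every `α`):**
`span{M(ω^ℓα) N((ω^ℓα)^n)}_{ℓ<r²} ⊆ span{coef_{x^iy^j}(M(x)N(y))}_{i,j<n}`; indeed
`M(β) N(γ)` lies in the coefficient span for all `β, γ`.
[cite: ForbesShpilka2013, Lemma 3.5 (arXiv: Lemma 10), "⊇" (first display)]
locator: paper:arxiv-1209.2408 p0014.txt:L5–L10 -/
theorem eval_mul_eval_mem_span_coeff (M N : Matrix (Fin r) (Fin r) K[X])
    (hM : ∀ a b, (M a b).natDegree < n) (hN : ∀ a b, (N a b).natDegree < n) (β γ : K) :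
    M.map (Polynomial.eval β) * N.map (Polynomial.eval γ) ∈
      Submodule.span K (Set.range fun ij : Fin n × Fin n =>
        (M.map fun f => f.coeff (ij.1 : ℕ)) * N.map fun f => f.coeff (ij.2 : ℕ)) := by
  rw [eval_mul_eval_eq_sum M N hM hN β γ]
  exact Submodule.sum_mem _ fun ij _ => Submodule.smul_mem _ _ (Submodule.subset_span ⟨ij, rfl⟩)

/-- The first claim of Lemma 3.5 as printed, for the `r²` evaluation products at
`β_ℓ = ω^ℓ α`, `γ_ℓ = β_ℓ^n`. [cite: ForbesShpilka2013, Lemma 3.5 (arXiv: Lemma 10), first display]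
locator: paper:arxiv-1209.2408 p0014.txt:L5–L6 -/
theorem span_evalProducts_le (M N : Matrix (Fin r) (Fin r) K[X])
    (hM : ∀ a b, (M a b).natDegree < n) (hN : ∀ a b, (N a b).natDegree < n) (ω α : K) :
    Submodule.span K (Set.range fun ℓ : Fin (r * r) =>
        M.map (Polynomial.eval (ω ^ (ℓ : ℕ) * α)) *
          N.map (Polynomial.eval ((ω ^ (ℓ : ℕ) * α) ^ n))) ≤
      Submodule.span K (Set.range fun ij : Fin n × Fin n =>
        (M.map fun f => f.coeff (ij.1 : ℕ)) * N.map fun f => f.coeff (ij.2 : ℕ)) := by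
  rw [Submodule.span_le]
  rintro _ ⟨ℓ, rfl⟩
  exact eval_mul_eval_mem_span_coeff M N hM hN _ _

/-- **[ForbesShpilka2013, Lemma 3.5 (arXiv Lemma 10)], second claim (the dimension reduction):**
"Let `M ∈ 𝔽[x]^{r×r}`, `N ∈ 𝔽[y]^{r×r}` be of degree `< n`. Let `ω` be an element of order
`≥ n²`. Then … except for `< n²r²` values of `α`,
`span{coef_{x^iy^j}(M(x)N(y))}_{i,j<n} = span{M(ω^ℓα) N((ω^ℓα)^n)}_{ℓ<r²}`." Typed: `1, ω, …,
ω^{n²-1}` distinct (the use of the order hypothesis), `r ≥ 1` (for `r = 0` the printed count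
`< 0` is vacuous-false while there is no bad `α`), and "except for `< n²r²` values" as: every finite
set of bad `α` has `< n²r²` elements. Proof as printed: flatten `r × r` matrices to `r²`-vectors;
the rows of the `n² × r²` matrix `C`, `C_{i+nj} = coef_i(M) coef_j(N)`, span the coefficient span,
the rows of `A_α C` (`A_α` the [ForbesShpilka2012] condenser, `FS2012.condenserAt ω α r² n²`) are
the `M(ω^ℓα) N((ω^ℓα)^n)`, and `rank(A_α C) = rank(C)` off `< n²r²` values of `α`
(`FS2012.card_lt_of_rank_lt`). [cite: ForbesShpilka2013, Lemma 3.5 (arXiv: Lemma 10); ForbesShpilka2012, Cor. 4.3]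
locator: paper:arxiv-1209.2408 p0014.txt:L3–L17 -/
theorem card_lt_of_span_evalProducts_ne {ω : K} (hω : Set.InjOn (fun k : ℕ => ω ^ k) (Set.Iio (n * n)))
    (M N : Matrix (Fin r) (Fin r) K[X]) (hM : ∀ a b, (M a b).natDegree < n)
    (hN : ∀ a b, (N a b).natDegree < n) (hr : 0 < r) (S : Finset K)
    (hS : ∀ α ∈ S,
      Submodule.span K (Set.range fun ℓ : Fin (r * r) =>
          M.map (Polynomial.eval (ω ^ (ℓ : ℕ) * α)) *
            N.map (Polynomial.eval ((ω ^ (ℓ : ℕ) * α) ^ n))) ≠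
        Submodule.span K (Set.range fun ij : Fin n × Fin n =>
          (M.map fun f => f.coeff (ij.1 : ℕ)) * N.map fun f => f.coeff (ij.2 : ℕ))) :
    S.card < (n * n) * (r * r) := by
  classical
  have hn : 0 < n := lt_of_le_of_lt (Nat.zero_le _) (hM ⟨0, hr⟩ ⟨0, hr⟩)
  -- the coefficient products and the evaluation products
  set P : Fin n × Fin n → Matrix (Fin r) (Fin r) K := fun ij =>
    (M.map fun f => f.coeff (ij.1 : ℕ)) * N.map fun f => f.coeff (ij.2 : ℕ) with hP
  set E : K → Fin (r * r) → Matrix (Fin r) (Fin r) K := fun α ℓ =>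
    M.map (Polynomial.eval (ω ^ (ℓ : ℕ) * α)) * N.map (Polynomial.eval ((ω ^ (ℓ : ℕ) * α) ^ n))
    with hE
  -- flattening `r × r` matrices into `r²`-vectors, and the index bijection `(i,j) ↦ i + n j`
  set fl : (Fin r × Fin r → K) ≃ₗ[K] Matrix (Fin r) (Fin r) K :=
    (LinearEquiv.curry K K (Fin r) (Fin r)).trans (Matrix.ofLinearEquiv K) with hfl
  have hfl_symm : ∀ (X : Matrix (Fin r) (Fin r) K) (ab : Fin r × Fin r),
      fl.symm X ab = X ab.1 ab.2 := by
    intro X ab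
    rfl
  set idx : Fin n × Fin n ≃ Fin (n * n) := (Equiv.prodComm _ _).trans finProdFinEquiv with hidx
  have hidx_val : ∀ ij : Fin n × Fin n, ((idx ij : Fin (n * n)) : ℕ) = (ij.1 : ℕ) + n * (ij.2 : ℕ) := by
    intro ij
    rfl
  -- the flattened coefficient matrix `C ∈ K^{n² × r²}`
  set C : Matrix (Fin (n * n)) (Fin r × Fin r) K := Matrix.of fun k ab => fl.symm (P (idx.symm k)) ab
    with hC
  -- rows of `A_α C` are the flattened evaluation products
  have hrow : ∀ (α : K) (ℓ : Fin (r * r)),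
      (FS2012.condenserAt ω α (r * r) (n * n) * C) ℓ = fl.symm (E α ℓ) := by
    intro α ℓ
    funext ab
    rw [hfl_symm, hE]
    simp only
    rw [eval_mul_eval_eq_sum M N hM hN, Matrix.sum_apply, Matrix.mul_apply]
    rw [← idx.sum_comp]
    refine Finset.sum_congr rfl fun ij _ => ?_
    rw [FS2012.condenserAt_apply, hC, Matrix.of_apply, Equiv.symm_apply_apply, hfl_symm,
      Matrix.smul_apply, smul_eq_mul, hidx_val, pow_add, pow_mul]
  -- hence the row span of `A_α C` is the flattened evaluation span, that of `C` the coefficient span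
  have hrowfun : ∀ α : K, (FS2012.condenserAt ω α (r * r) (n * n) * C).row = ⇑fl.symm ∘ E α := by
    intro α
    funext ℓ
    exact hrow α ℓ
  have hCrow : C.row = (⇑fl.symm ∘ P) ∘ ⇑idx.symm := by
    funext k
    rfl
  have hspanAC : ∀ α : K,
      Submodule.span K (Set.range (FS2012.condenserAt ω α (r * r) (n * n) * C).row) =
        (Submodule.span K (Set.range (E α))).map (fl.symm : Matrix (Fin r) (Fin r) K →ₗ[K] _) := by
    intro α
    rw [Submodule.map_span, LinearEquiv.coe_coe, ← Set.range_comp, hrowfun α]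
  have hspanC : Submodule.span K (Set.range C.row) =
      (Submodule.span K (Set.range P)).map (fl.symm : Matrix (Fin r) (Fin r) K →ₗ[K] _) := by
    rw [Submodule.map_span, LinearEquiv.coe_coe, ← Set.range_comp, hCrow,
      idx.symm.surjective.range_comp]
  -- the bad `α` of the statement are bad for the rank
  have hrankC : C.rank = Module.finrank K (Submodule.span K (Set.range P)) := by
    rw [Matrix.rank_eq_finrank_span_row, hspanC, LinearEquiv.finrank_map_eq]
  have hrankAC : ∀ α : K, (FS2012.condenserAt ω α (r * r) (n * n) * C).rank =
      Module.finrank K (Submodule.span K (Set.range (E α))) := by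
    intro α
    rw [Matrix.rank_eq_finrank_span_row, hspanAC, LinearEquiv.finrank_map_eq]
  have hle : ∀ α : K, Submodule.span K (Set.range (E α)) ≤ Submodule.span K (Set.range P) :=
    fun α => span_evalProducts_le M N hM hN ω α
  have hbad : ∀ α ∈ S, (FS2012.condenserAt ω α (r * r) (n * n) * C).rank < C.rank := by
    intro α hα
    have hne := hS α hα
    have hlt : Module.finrank K (Submodule.span K (Set.range (E α))) <
        Module.finrank K (Submodule.span K (Set.range P)) := by
      refine lt_of_le_of_ne (Submodule.finrank_mono (hle α)) fun h => hne ?_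
      exact Submodule.eq_of_le_of_finrank_eq (hle α) h
    rwa [hrankAC, hrankC]
  -- count
  by_cases hC0 : C.rank = 0
  · have hS0 : S = ∅ := by
      refine Finset.eq_empty_of_forall_notMem fun α hα => ?_
      have h := hbad α hα
      rw [hC0] at h
      exact Nat.not_lt_zero _ h
    subst hS0
    rw [Finset.card_empty]
    exact Nat.mul_pos (Nat.mul_pos hn hn) (Nat.mul_pos hr hr)
  · have h1 : 1 ≤ C.rank := Nat.one_le_iff_ne_zero.mpr hC0
    have h2 : C.rank ≤ r * r := by
      simpa [Fintype.card_prod, Fintype.card_fin] using Matrix.rank_le_card_width C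
    exact FS2012.card_lt_of_rank_lt hω C h1 h2 S hbad

end DimensionReduction

/-! ### Lemma 3.6 (arXiv Lemma 12): the merging step (spans over all of `K`; abstract nodes) -/

section Merge

variable {m m' : Type*} {r : ℕ}

/-- Lemma 3.3 with `S = K` ("applying Lemma 3.3 … to the variable `x`", with "`|𝔽| ≥ (Dnm)²`"):
if `K` has at least `d` elements then `span{M(x)}_{x∈K} = span{coef_i(M)}_{i<d}`.
[cite: ForbesShpilka2013, Lemma 3.3 (arXiv: Lemma 8); Lemma 3.6 (arXiv: Lemma 12), proof, eq. (2)]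
locator: paper:arxiv-1209.2408 p0014.txt:L33–L35 -/
theorem span_eval_univ_eq_span_coeff (M : Matrix m m' K[X]) {d : ℕ}
    (hM : ∀ a b, (M a b).natDegree < d) (hK : ∃ S : Finset K, d ≤ S.card) :
    Submodule.span K (Set.range fun x : K => M.map (Polynomial.eval x)) =
      Submodule.span K (Set.range fun i : Fin d => M.map fun f => f.coeff (i : ℕ)) := by
  apply le_antisymm
  · rw [Submodule.span_le]
    rintro _ ⟨x, rfl⟩
    exact map_eval_mem_span_coeff M hM x
  · obtain ⟨S, hS⟩ := hK
    rw [← span_eval_eq_span_coeff M hM S hS]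
    refine Submodule.span_mono ?_
    rintro _ ⟨β, rfl⟩
    exact ⟨(β : K), rfl⟩

/-- `span{R(x) T(y)}_{x,y∈K} = span{coef_i(R) coef_j(T)}_{i,j<d}` for layers of degree `< d` over a
field with `≥ d` elements (Lemma 3.3 twice and Lemma 3.2).
[cite: ForbesShpilka2013, Lemma 3.6 (arXiv: Lemma 12), proof, eq. (2)] locator: paper:arxiv-1209.2408 p0014.txt:L33–L35 -/
theorem span_evalProd_univ_eq_span_coeff (R T : Matrix (Fin r) (Fin r) K[X]) {d : ℕ}
    (hR : ∀ a b, (R a b).natDegree < d) (hT : ∀ a b, (T a b).natDegree < d)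
    (hK : ∃ S : Finset K, d ≤ S.card) :
    Submodule.span K (Set.range fun xy : K × K =>
        R.map (Polynomial.eval xy.1) * T.map (Polynomial.eval xy.2)) =
      Submodule.span K (Set.range fun ij : Fin d × Fin d =>
        (R.map fun f => f.coeff (ij.1 : ℕ)) * T.map fun f => f.coeff (ij.2 : ℕ)) := by
  apply le_antisymm
  · rw [Submodule.span_le]
    rintro _ ⟨xy, rfl⟩
    exact eval_mul_eval_mem_span_coeff R T hR hT xy.1 xy.2
  · rw [Submodule.span_le]
    rintro _ ⟨ij, rfl⟩
    have h1 : (R.map fun f => f.coeff (ij.1 : ℕ)) ∈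
        Submodule.span K (Set.range fun x : K => R.map (Polynomial.eval x)) := by
      rw [span_eval_univ_eq_span_coeff R hR hK]
      exact Submodule.subset_span ⟨ij.1, rfl⟩
    have h2 : (T.map fun f => f.coeff (ij.2 : ℕ)) ∈
        Submodule.span K (Set.range fun y : K => T.map (Polynomial.eval y)) := by
      rw [span_eval_univ_eq_span_coeff T hT hK]
      exact Submodule.subset_span ⟨ij.2, rfl⟩
    have h12 := Submodule.mul_mem_mul h1 h2
    rw [Submodule.span_mul_span] at h12
    refine Submodule.span_mono ?_ h12
    rintro _ ⟨_, ⟨x, rfl⟩, _, ⟨y, rfl⟩, rfl⟩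
    exact ⟨(x, y), rfl⟩

/-- **[ForbesShpilka2013, Lemma 3.6 (arXiv Lemma 12)], the merging step, for a GOOD `α`:** if the
dimension reduction of Lemma 3.5 holds at `α` for the layers `R(x)`, `T(y)` (degree `< d`;
`span{R(ω^ℓα) T((ω^ℓα)^d)}_{ℓ<r²} = span{coef_i(R) coef_j(T)}`), and `U, V : K → K^{r×r}` pass
through the evaluation points — `U(β_ℓ) = R(ω^ℓα)`, `V(β_ℓ) = T((ω^ℓα)^d)` for `ℓ < r²` (in print:
`U(z) = ∏_i M_i(Σ_ℓ f_i(ω^ℓα) p_ℓ(z))`, `V(z) = ∏_i N_i(Σ_ℓ g_i((ω^ℓα)^{Dnm}) p_ℓ(z))` with the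
Lagrange polynomials `p_ℓ` at distinct `β_ℓ`, so that "`U(β_ℓ) = R(ω^ℓα)` and
`V(β_ℓ) = T((ω^ℓα)^{Dnm})`") — then `span{R(x) T(y)}_{x,y∈K} ⊆ span{U(z) V(z)}_{z∈K}`
(eqs. (1)–(3) of the printed proof). The nodes and the curves are abstract here; the printed
instance (products of `D` layers composed with curves of degree `≤ m`, `d = Dnm`) is a special case.
[cite: ForbesShpilka2013, Lemma 3.6 (arXiv: Lemma 12), proof, eqs. (1)–(3)]
locator: paper:arxiv-1209.2408 p0014.txt:L27–L43 -/
theorem span_evalProd_le_span_of_nodes (R T : Matrix (Fin r) (Fin r) K[X]) {d : ℕ}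
    (hR : ∀ a b, (R a b).natDegree < d) (hT : ∀ a b, (T a b).natDegree < d)
    (hK : ∃ S : Finset K, d ≤ S.card) {ω α : K}
    (hgood : Submodule.span K (Set.range fun ℓ : Fin (r * r) =>
        R.map (Polynomial.eval (ω ^ (ℓ : ℕ) * α)) *
          T.map (Polynomial.eval ((ω ^ (ℓ : ℕ) * α) ^ d))) =
      Submodule.span K (Set.range fun ij : Fin d × Fin d =>
        (R.map fun f => f.coeff (ij.1 : ℕ)) * T.map fun f => f.coeff (ij.2 : ℕ)))
    (U V : K → Matrix (Fin r) (Fin r) K) (β : Fin (r * r) → K)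
    (hU : ∀ ℓ, U (β ℓ) = R.map (Polynomial.eval (ω ^ (ℓ : ℕ) * α)))
    (hV : ∀ ℓ, V (β ℓ) = T.map (Polynomial.eval ((ω ^ (ℓ : ℕ) * α) ^ d))) :
    Submodule.span K (Set.range fun xy : K × K =>
        R.map (Polynomial.eval xy.1) * T.map (Polynomial.eval xy.2)) ≤
      Submodule.span K (Set.range fun z : K => U z * V z) := by
  rw [span_evalProd_univ_eq_span_coeff R T hR hT hK, ← hgood, Submodule.span_le]
  rintro _ ⟨ℓ, rfl⟩
  refine Submodule.subset_span ⟨β ℓ, ?_⟩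
  simp only [hU ℓ, hV ℓ]

/-- **[ForbesShpilka2013, Lemma 3.6 (arXiv Lemma 12)], the count:** with `1, ω, …, ω^{d²-1}`
distinct (print: `ω` of order `≥ (Dnm)²`, `d = Dnm`) and, for each `α`, curves `U_α, V_α` through
the evaluation points as above, the merging inclusion
`span{R(x) T(y)}_{x,y} ⊆ span{U_α(z) V_α(z)}_z` fails for fewer than `d²r²` (print: `(Dnmr)²`)
values of `α` — every finite set of such `α` has `< d²r²` elements (by Lemma 3.5,
`card_lt_of_span_evalProducts_ne`). [cite: ForbesShpilka2013, Lemma 3.6 (arXiv: Lemma 12)]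
locator: paper:arxiv-1209.2408 p0014.txt:L21–L27 -/
theorem card_lt_of_not_span_evalProd_le {ω : K} {d : ℕ}
    (hω : Set.InjOn (fun k : ℕ => ω ^ k) (Set.Iio (d * d)))
    (R T : Matrix (Fin r) (Fin r) K[X]) (hR : ∀ a b, (R a b).natDegree < d)
    (hT : ∀ a b, (T a b).natDegree < d) (hr : 0 < r)
    (U V : K → K → Matrix (Fin r) (Fin r) K) (β : Fin (r * r) → K)
    (hU : ∀ α ℓ, U α (β ℓ) = R.map (Polynomial.eval (ω ^ (ℓ : ℕ) * α)))
    (hV : ∀ α ℓ, V α (β ℓ) = T.map (Polynomial.eval ((ω ^ (ℓ : ℕ) * α) ^ d)))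
    (S : Finset K)
    (hS : ∀ α ∈ S, ¬ Submodule.span K (Set.range fun xy : K × K =>
        R.map (Polynomial.eval xy.1) * T.map (Polynomial.eval xy.2)) ≤
      Submodule.span K (Set.range fun z : K => U α z * V α z)) :
    S.card < (d * d) * (r * r) := by
  classical
  have hd : 0 < d := lt_of_le_of_lt (Nat.zero_le _) (hR ⟨0, hr⟩ ⟨0, hr⟩)
  -- `K` has at least `d` elements: `1, ω, …, ω^{d-1}` are distinct
  have hK : ∃ S : Finset K, d ≤ S.card := by
    refine ⟨(Finset.range d).image fun k => ω ^ k, ?_⟩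
    rw [Finset.card_image_of_injOn, Finset.card_range]
    intro a ha b hb hab
    have ha' : a < d * d := lt_of_lt_of_le (Finset.mem_range.mp (Finset.mem_coe.mp ha))
      (Nat.le_mul_of_pos_left d hd)
    have hb' : b < d * d := lt_of_lt_of_le (Finset.mem_range.mp (Finset.mem_coe.mp hb))
      (Nat.le_mul_of_pos_left d hd)
    exact hω (Set.mem_Iio.mpr ha') (Set.mem_Iio.mpr hb') hab
  refine card_lt_of_span_evalProducts_ne hω R T hR hT hr S fun α hα hgood => ?_
  exact hS α hα (span_evalProd_le_span_of_nodes R T hR hT hK hgood (U α) (V α) β (hU α) (hV α))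

end Merge

end FS2013

end Literature.Computability.AlgebraicComplexity
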